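import Literature.AlgebraicGeometry.Resolution.NormalAscentCompletion
import Literature.AlgebraicGeometry.Resolution.NormalBirationalQuasiFinite
import Literature.AlgebraicGeometry.Resolution.IntegralClosureEssFiniteType
import Literature.AlgebraicGeometry.Resolution.RegularLocalRingsFlatDescent
import Mathlib.RingTheory.Ideal.MinimalPrime.Localization
import HarnessLib

/-!
# Cossart–Piltant 2019, end of the proof of Prop. 4.8: the descent of regularity from `T'_{P'}` to `T_P`

Topic: `Literature/AlgebraicGeometry/Resolution`. The last paragraph of the proof of journal
Prop. 4.8 = arXiv v1 Prop. 4.6 (p. 53) of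

* V. Cossart, O. Piltant, *Resolution of singularities of arithmetical threefolds*, J. Algebra
  529 (2019) 268–535 = arXiv:1412.0868,

reads, for a quasi-excellent local domain `A` with quotient field `K`, completion `Â`, a minimal
prime `P̂₁` of `Â` with `K̂₁ = QF(Â/P̂₁)`, the local ring `𝒪 := 𝒪_{Ŷ,ŷ}` of a resolution of
`Spec Â` at the centre `ŷ` of an extension `v̂` of the valuation `v`, and the integral closure
`T` of `A[g₁, …, g_d]` in `K` (a finitely generated `A`-algebra with `T ⊆ 𝒪 ∩ K`):

> "To complete the proof, it must be proved that `T_P` is regular, where `P := m_v ∩ T`. By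
> [EGA IV] lemma 7.9.3.1, it is sufficient to prove that `T' := T ⊗_A Â` is regular at the
> center `P' := m_ŷ ∩ T'` of `v̂`. Since `T_P` is normal, `T'_{P'}` is also normal ibid. and
> (7.8.3)(v). There are inclusions `Â ⊂ T'_{P'} ⊆ 𝒪_{Ŷ,ŷ}`. By (5101)-(5102), the right-hand
> side inclusion satisfies `√(P'𝒪_{Ŷ,ŷ}) = m_ŷ`, so `𝒪_{Ŷ,ŷ} = T'_{P'}` and the proof is
> complete."

This file PROVES that paragraph as an abstract statement about the data
`(A, K, T, Â, K̂₁, 𝒪)` (`isRegularLocalRing_localization_of_descent_data`), assembling the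
bricks of the tree:

* `T'_{P'}` is a normal domain — `isDomain_and_isIntegrallyClosed_localization_tensor_adicCompletion`
  (`NormalAscentCompletion.lean`; Stacks 0BFK/07C1 for the local G-ring `A`);
* `T'_{P'} → 𝒪` is injective — the kernel of `T' → K̂₁` is a minimal prime of `T'`
  (`ker_mem_minimalPrimes_of_tensor`: `t s = 1 ⊗ â` for `s ∈ T'`, `t ∈ A ∖ 0`), contained in
  `P'`, hence zero in the domain `T'_{P'}`;
* "so `𝒪_{Ŷ,ŷ} = T'_{P'}`" — Zariski's Main Theorem in the birational local form
  `bijective_algebraMap_of_essFiniteType_of_forall_isPrime` (`NormalBirationalQuasiFinite.lean`),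
  whose hypotheses are: `𝒪` local, essentially of finite type over `T'_{P'}` (it is so over `Â`),
  inside `K̂₁ = Frac T'_{P'}`, `√(P'𝒪) = m_ŷ`, and residue field algebraic (the centre `ŷ` of `v̂`
  has residue field inside `k_v̂`, algebraic over `k`);
* `T'_{P'} = 𝒪` regular ⇒ `T_P` regular — EGA IV 7.9.3.1 = flat local descent of regularity
  (`IsRegularLocalRing.of_flat_of_isLocalHom`, Matsumura 23.7 (i)).

The hypotheses on `𝒪` (here `S`) are exactly what the preceding part of the printed proof
provides: `S` is a regular local ring, essentially of finite type over `Â` and dominating it,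
embedded in `K̂₁ ⊇ K`; `T ⊆ K` maps into `S` over `A`; every prime of `S` containing
the image of `P = m_S ∩ T` is `m_S` ((5101)-(5102)); the residue field of `S` is algebraic over
that of `A`. Everything is PROVED; no definitions, no named facts.

## Sources

* V. Cossart, O. Piltant, J. Algebra 529 (2019) 268–535 = arXiv:1412.0868, proof of Prop. 4.8
  (arXiv v1: Prop. 4.6, p. 53, last paragraph). [CossartPiltant2019]
* A. Grothendieck, EGA IV₂, 7.9.3.1, 7.8.3 (v) (as quoted there).
* The Stacks Project, Tags 00Q9, 0BFK, 07C1. [StacksProject]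
-/

noncomputable section

open IsLocalRing TensorProduct Polynomial

namespace Literature.AlgebraicGeometry.Resolution

universe u

/-! ## The kernel of `T ⊗_A Â → K̂₁` is a minimal prime -/

section KernelMinimal

variable {A : Type u} [CommRing A] {T : Type u} [CommRing T] [Algebra A T]
  {B : Type u} [CommRing B] [Algebra A B]

/-- If every element of `T` becomes an element of `A` after multiplication by a non-zero element
of `A` (e.g. `A ⊆ T ⊆ Frac A`), then every element of `T ⊗[A] B` becomes an element `1 ⊗ b`
after multiplication by a non-zero element of `A`. [folklore] -/
theorem exists_smul_eq_one_tmul [IsDomain A]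
    (hfrac : ∀ x : T, ∃ a t : A, t ≠ 0 ∧ t • x = algebraMap A T a) (s : T ⊗[A] B) :
    ∃ t : A, t ≠ 0 ∧ ∃ b : B, t • s = (1 : T) ⊗ₜ[A] b := by
  induction s using TensorProduct.induction_on with
  | zero => exact ⟨1, one_ne_zero, 0, by simp⟩
  | tmul x b =>
    obtain ⟨a, t, ht, htx⟩ := hfrac x
    refine ⟨t, ht, a • b, ?_⟩
    rw [TensorProduct.smul_tmul', htx, Algebra.algebraMap_eq_smul_one, TensorProduct.smul_tmul,
      TensorProduct.tmul_smul]
  | add x y hx hy =>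
    obtain ⟨t₁, ht₁, b₁, h₁⟩ := hx
    obtain ⟨t₂, ht₂, b₂, h₂⟩ := hy
    refine ⟨t₁ * t₂, mul_ne_zero ht₁ ht₂, t₂ • b₁ + t₁ • b₂, ?_⟩
    rw [smul_add, mul_comm t₁ t₂, mul_smul, h₁, mul_comm t₂ t₁, mul_smul, h₂,
      TensorProduct.tmul_add, TensorProduct.tmul_smul, TensorProduct.tmul_smul]

/-- **The kernel of `T ⊗_A B → K₁` is a minimal prime.** Let `A` be a domain, `T` an
`A`-algebra of fractions of `A` (`A ⊆ T ⊆ Frac A`), `B` any `A`-algebra and `ψ : T ⊗_A B → K₁` a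
ring homomorphism to a domain which does not kill the non-zero elements of `A` and whose
restriction to `B` has a minimal prime of `B` as kernel. Then `ker ψ` is a minimal prime of
`T ⊗_A B`: for `s ∈ ker ψ` write `t s = 1 ⊗ b`, so `b ∈ ker ψ|_B`; a smaller prime `𝔓₀` still
contracts to `ker ψ|_B` by minimality, so contains `1 ⊗ b = ts`, and `t ∉ 𝔓₀`. [folklore] -/
theorem ker_mem_minimalPrimes_of_tensor [IsDomain A] {K₁ : Type u} [CommRing K₁] [IsDomain K₁]
    (hfrac : ∀ x : T, ∃ a t : A, t ≠ 0 ∧ t • x = algebraMap A T a) (ψ : T ⊗[A] B →+* K₁)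
    (hψA : ∀ t : A, t ≠ 0 → ψ (algebraMap A (T ⊗[A] B) t) ≠ 0)
    (hker : RingHom.ker (ψ.comp (Algebra.TensorProduct.includeRight (R := A) (A := T)).toRingHom) ∈
      minimalPrimes B) :
    RingHom.ker ψ ∈ minimalPrimes (T ⊗[A] B) := by
  haveI : (RingHom.ker ψ).IsPrime := RingHom.ker_isPrime ψ
  refine ⟨⟨inferInstance, bot_le⟩, fun 𝔓₀ h𝔓₀ hle => ?_⟩
  haveI : 𝔓₀.IsPrime := h𝔓₀.1
  intro s hs
  obtain ⟨t, ht, b, htsb⟩ := exists_smul_eq_one_tmul (B := B) hfrac s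
  -- `b ∈ ker ψ|_B`
  have hb : b ∈ RingHom.ker (ψ.comp
      (Algebra.TensorProduct.includeRight (R := A) (A := T)).toRingHom) := by
    rw [RingHom.mem_ker, RingHom.comp_apply]
    change ψ ((1 : T) ⊗ₜ[A] b) = 0
    rw [← htsb, Algebra.smul_def, map_mul, RingHom.mem_ker.mp hs, mul_zero]
  -- `𝔓₀ ∩ B = ker ψ|_B` by minimality
  have hcontr : RingHom.ker (ψ.comp
      (Algebra.TensorProduct.includeRight (R := A) (A := T)).toRingHom) ≤
      𝔓₀.comap (Algebra.TensorProduct.includeRight (R := A) (A := T)).toRingHom := by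
    apply hker.2 ⟨Ideal.IsPrime.comap _, bot_le⟩
    intro x hx
    rw [Ideal.mem_comap] at hx
    exact hle hx
  have h1 : (1 : T) ⊗ₜ[A] b ∈ 𝔓₀ := hcontr hb
  rw [← htsb, Algebra.smul_def] at h1
  refine ((Ideal.IsPrime.mem_or_mem ‹𝔓₀.IsPrime› h1).resolve_left fun h2 => ?_)
  exact hψA t ht (RingHom.mem_ker.mp (hle h2))

end KernelMinimal

section MinimalToBot

variable {R : Type u} [CommRing R] (P : Ideal R) [P.IsPrime] (N : Type u) [CommRing N]
  [Algebra R N] [IsLocalization.AtPrime N P]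

/-- In the localisation `N = R_P` of `R` at a prime `P`, a minimal prime `𝔓 ⊆ P` of `R`
extends to a minimal prime of `N`; if `N` is a domain, the elements of `𝔓` therefore vanish
in `N`. [folklore] -/
theorem algebraMap_eq_zero_of_mem_minimalPrimes [IsDomain N] {𝔓 : Ideal R}
    (h𝔓 : 𝔓 ∈ minimalPrimes R) (hle : 𝔓 ≤ P) {s : R} (hs : s ∈ 𝔓) : algebraMap R N s = 0 := by
  haveI : 𝔓.IsPrime := h𝔓.1.1
  have hdisj : Disjoint (P.primeCompl : Set R) 𝔓 := by
    rw [Set.disjoint_left]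
    intro x hx hx𝔓
    exact hx (hle hx𝔓)
  have hmin : 𝔓.map (algebraMap R N) ∈ minimalPrimes N := by
    have h1 : 𝔓.map (algebraMap R N) ∈ ((⊥ : Ideal R).map (algebraMap R N)).minimalPrimes := by
      rw [IsLocalization.minimalPrimes_map P.primeCompl N ⊥]
      change (𝔓.map (algebraMap R N)).under R ∈ minimalPrimes R
      rw [IsLocalization.under_map_of_isPrime_disjoint P.primeCompl N inferInstance hdisj]
      exact h𝔓
    rwa [Ideal.map_bot] at h1
  rw [IsDomain.minimalPrimes_eq_singleton_bot, Set.mem_singleton_iff] at hmin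
  have : algebraMap R N s ∈ 𝔓.map (algebraMap R N) := Ideal.mem_map_of_mem _ hs
  rw [hmin] at this
  exact Ideal.mem_bot.mp this

end MinimalToBot

/-! ## The local homomorphism `T'_{P'} → S` induced by `ψ : T' → S` -/

section LiftToLocal

variable {T' S : Type u} [CommRing T'] [CommRing S] [IsLocalRing S] (ψ : T' →+* S)
  (N : Type u) [CommRing N] [Algebra T' N]
  [IsLocalization.AtPrime N ((maximalIdeal S).comap ψ)]

/-- For `ψ : T' → S` with `S` local and `P' := ψ⁻¹(𝔪_S)`, the induced homomorphism
`ψN : T'_{P'} → S` exists, is local, and is injective as soon as `T'_{P'}` is a domain and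
`ker ψ` is a minimal prime of `T'` (then `ker ψ ⊆ P'` extends to the unique minimal prime `0` of
the domain `T'_{P'}`). [folklore] -/
theorem exists_lift_localization_comap :
    ∃ ψN : N →+* S, (∀ s : T', ψN (algebraMap T' N s) = ψ s) ∧ IsLocalHom ψN ∧
      (IsDomain N → RingHom.ker ψ ∈ minimalPrimes T' → Function.Injective ψN) := by
  set P' : Ideal T' := (maximalIdeal S).comap ψ with hP'def
  have hunit : ∀ y : P'.primeCompl, IsUnit (ψ y) := fun y =>
    IsLocalRing.notMem_maximalIdeal.mp fun h => y.2 h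
  let ψN : N →+* S := IsLocalization.lift (M := P'.primeCompl) hunit
  have hψN : ∀ s : T', ψN (algebraMap T' N s) = ψ s := fun s => IsLocalization.lift_eq hunit s
  refine ⟨ψN, hψN, ⟨fun x hx => ?_⟩, fun hdom hker => ?_⟩
  · obtain ⟨s, y, rfl⟩ := IsLocalization.exists_mk'_eq P'.primeCompl x
    rw [IsLocalization.AtPrime.isUnit_mk'_iff]
    intro hsP
    have h1 : ψN (IsLocalization.mk' N s y) * ψ y = ψ s := by
      rw [← hψN y, ← map_mul, IsLocalization.mk'_spec, hψN]
    have h2 : IsUnit (ψ s) := by rw [← h1]; exact hx.mul (hunit y)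
    exact IsLocalRing.notMem_maximalIdeal.mpr h2 hsP
  · haveI := hdom
    have hle : RingHom.ker ψ ≤ P' := fun s hs => by
      rw [RingHom.mem_ker] at hs
      change ψ s ∈ maximalIdeal S
      rw [hs]
      exact Ideal.zero_mem _
    have hker0 : ∀ x : N, ψN x = 0 → x = 0 := by
      intro x hx
      obtain ⟨s, y, rfl⟩ := IsLocalization.exists_mk'_eq P'.primeCompl x
      have hs : ψ s = 0 := by
        have h1 : ψN (IsLocalization.mk' N s y) * ψN (algebraMap T' N y) =
            ψN (algebraMap T' N s) := by
          rw [← map_mul, IsLocalization.mk'_spec]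
        rw [hx, zero_mul, hψN] at h1
        exact h1.symm
      rw [IsLocalization.mk'_eq_zero_iff]
      have h0 : algebraMap T' N s = 0 :=
        algebraMap_eq_zero_of_mem_minimalPrimes P' N hker hle (RingHom.mem_ker.mpr hs)
      exact (IsLocalization.map_eq_zero_iff P'.primeCompl N s).mp h0
    intro x₁ x₂ hx
    exact sub_eq_zero.mp (hker0 _ (by rw [map_sub, hx, sub_self]))

end LiftToLocal

/-! ## EGA IV 7.9.3.1: regularity of `T'_{P'}` descends to `T_P` (`T' = T ⊗_A Â`) -/

section FlatDescent

variable {A : Type u} [CommRing A] {T : Type u} [CommRing T] [Algebra A T] [IsNoetherianRing T]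
  {B : Type u} [CommRing B] [Algebra A B] [Module.Flat A B]

/-- **EGA IV 7.9.3.1 as used by Cossart–Piltant** ("it is sufficient to prove that
`T' := T ⊗_A Â` is regular at `P'`"): for a flat `A`-algebra `B` (e.g. `Â`), a Noetherian
`A`-algebra `T`, and a prime `P'` of `T ⊗_A B` over the prime `P` of `T`, if `(T ⊗_A B)_{P'}` is
regular then so is `T_P` — the local homomorphism `T_P → (T ⊗_A B)_{P'}` is flat, and
regularity descends along flat local homomorphisms (Matsumura Thm. 23.7 (i),
`IsRegularLocalRing.of_flat_of_isLocalHom`). [cite: Matsumura1987, Thm. 23.7 (i)]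
[cite: CossartPiltant2019, proof of Prop. 4.8 (arXiv v1: Prop. 4.6, p. 53)] -/
theorem isRegularLocalRing_localization_of_tensor (P : Ideal T) [P.IsPrime]
    (P' : Ideal (T ⊗[A] B)) [P'.IsPrime] [P'.LiesOver P]
    [IsRegularLocalRing (Localization.AtPrime P')] : IsRegularLocalRing (Localization.AtPrime P) := by
  set T' := T ⊗[A] B
  set TP := Localization.AtPrime P
  set N := Localization.AtPrime P'
  letI : Algebra TP N := Localization.AtPrime.algebraOfLiesOver P P'
  haveI : Module.Flat T' N := IsLocalization.flat N P'.primeCompl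
  haveI : Module.Flat T N := Module.Flat.trans T T' N
  haveI : Module.Flat TP N := (Module.flat_iff_of_isLocalization TP P.primeCompl N).mpr inferInstance
  haveI : IsLocalHom (algebraMap TP N) := by
    change IsLocalHom (Localization.localRingHom P P' (algebraMap T T') Ideal.LiesOver.over)
    infer_instance
  haveI : IsNoetherianRing TP := IsLocalization.isNoetherianRing P.primeCompl TP inferInstance
  exact IsRegularLocalRing.of_flat_of_isLocalHom TP N

end FlatDescent

/-! ## The core of the descent: Zariski's Main Theorem applied to `T'_{P'} → S` -/

section Core

variable {R N S K₁ : Type u} [CommRing R] [CommRing N] [IsDomain N] [IsIntegrallyClosed N]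
  [IsLocalRing N] [CommRing S] [IsRegularLocalRing S] [Field K₁]
  [Algebra R N] [Algebra R S] [Algebra R K₁] [Algebra S K₁] [IsScalarTower R S K₁]
  [Algebra.EssFiniteType R S]

/-- **"so `𝒪_{Ŷ,ŷ} = T'_{P'}`", abstractly.** Let `R → N → S` be ring maps (`R = Â`,
`N = T'_{P'}`, `S = 𝒪_{Ŷ,ŷ}`) with `N` an integrally closed local domain, `S` a regular local
ring essentially of finite type over `R`, `ψN : N → S` injective and local, `S` embedded in a
field `K₁` all of whose elements are fractions of elements of `R` (`K₁ = Frac(R/P₁) = Frac N`).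
If every prime of `S` containing `ψN(𝔪_N)S` is `𝔪_S` and every element of `S` is a root modulo
`𝔪_S` of a polynomial over `N` with a unit coefficient, then `ψN` is bijective and `N` is a
regular local ring (Zariski's Main Theorem, `bijective_algebraMap_of_essFiniteType_of_forall_isPrime`).
[cite: CossartPiltant2019, proof of Prop. 4.8 (arXiv v1: Prop. 4.6, p. 53)] -/
theorem isRegularLocalRing_of_descent_core (ψN : N →+* S) (hinj : Function.Injective ψN)
    (hloc : IsLocalHom ψN) (hcomm : ψN.comp (algebraMap R N) = algebraMap R S)
    (hSK₁ : Function.Injective (algebraMap S K₁))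
    (hK₁ : ∀ z : K₁, ∃ a b : R, z = algebraMap R K₁ a / algebraMap R K₁ b)
    (hrad : ∀ Q : Ideal S, Q.IsPrime → (maximalIdeal N).map ψN ≤ Q → Q = maximalIdeal S)
    (halg : ∀ x : S, ∃ p : N[X], (∃ i, p.coeff i ∉ maximalIdeal N) ∧
      p.eval₂ ψN x ∈ maximalIdeal S) :
    Function.Bijective ψN ∧ IsRegularLocalRing N := by
  letI : Algebra N S := ψN.toAlgebra
  haveI : IsLocalHom (algebraMap N S) := hloc
  haveI : IsScalarTower R N S := IsScalarTower.of_algebraMap_eq' hcomm.symm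
  haveI : Algebra.EssFiniteType N S := Algebra.EssFiniteType.of_comp R N S
  letI : Algebra N K₁ := ((algebraMap S K₁).comp ψN).toAlgebra
  haveI : IsScalarTower N S K₁ := IsScalarTower.of_algebraMap_eq fun _ => rfl
  haveI : IsScalarTower R N K₁ := IsScalarTower.of_algebraMap_eq fun c => by
    rw [IsScalarTower.algebraMap_apply R S K₁, IsScalarTower.algebraMap_apply R N S,
      ← IsScalarTower.algebraMap_apply N S K₁]
  have hNK₁inj : Function.Injective (algebraMap N K₁) := fun x y hxy => hinj (hSK₁ hxy)
  haveI : FaithfulSMul N K₁ := (faithfulSMul_iff_algebraMap_injective N K₁).mpr hNK₁inj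
  haveI : IsFractionRing N K₁ := IsFractionRing.of_field N K₁ fun z => by
    obtain ⟨a, b, rfl⟩ := hK₁ z
    exact ⟨algebraMap R N a, algebraMap R N b, by
      rw [← IsScalarTower.algebraMap_apply R N K₁, ← IsScalarTower.algebraMap_apply R N K₁]⟩
  have hbij : Function.Bijective (algebraMap N S) :=
    bijective_algebraMap_of_essFiniteType_of_forall_isPrime (N := N) (S := S) (K := K₁) hSK₁
      hrad halg
  exact ⟨hbij, IsRegularLocalRing.of_ringEquiv (RingEquiv.ofBijective (algebraMap N S) hbij).symm⟩

end Core

/-! ## The descent statement -/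

section Descent

variable {A : Type u} [CommRing A] [IsDomain A] [IsLocalRing A]
  {K : Type u} [Field K] [Algebra A K] [IsFractionRing A K]

set_option maxHeartbeats 1600000 in
/-- **Cossart–Piltant 2019, last paragraph of the proof of Prop. 4.8 (arXiv v1 Prop. 4.6,
p. 53)** — PROVED in the following abstract form. Data: a local domain `A` which is a G-ring
(e.g. quasi-excellent), with fraction field `K` and completion `Â`; a field `K̂₁` under `Â` with
kernel a minimal prime `P̂₁` of `Â` and `K̂₁ = Frac(Â/P̂₁)`, containing `K` compatibly; a regular
local ring `S` (in the source: `𝒪_{Ŷ,ŷ}`) essentially of finite type over `Â`, dominating `Â`,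
embedded in `K̂₁` over `Â`; a finitely generated `A`-subalgebra `T ⊆ K`, integrally closed in `K`,
with an `A`-algebra map `T → S` (automatically the restriction of `K → K̂₁`, as `T ⊆ Frac A`);
with `P := m_S ∩ T`. Hypotheses: every prime
of `S` containing the image of `P` is `m_S` ("`√(P'𝒪) = m_ŷ`", from (5101)-(5102)), and every
element of `S` is a root modulo `m_S` of a polynomial over `A` with a coefficient outside `m_A`
(the residue field of `S` is algebraic over that of `A`; in the source because it embeds in
`k_v̂`). Conclusion: `T_P` is a regular local ring. Proof: `T' := T ⊗_A Â → S`, `P' := m_S ∩ T'`;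
`T'_{P'}` is a normal domain (Stacks 0BFK along the regular `T → T'`), maps injectively to `S`
(the kernel of `T' → K̂₁` is a minimal prime inside `P'`), `S` is essentially of finite type and
birational over it with `√(m_{T'_{P'}} S) = m_S` and algebraic residue field, so `T'_{P'} = S` by
Zariski's Main Theorem; hence `T'_{P'}` is regular and so is `T_P` by flat descent (EGA IV
7.9.3.1). [cite: CossartPiltant2019, proof of Prop. 4.8 (arXiv v1: Prop. 4.6, p. 53)] -/
theorem isRegularLocalRing_localization_of_descent_data (hA : IsGRing A)
    -- the completion side: `K̂₁ = Frac(Â/P̂₁)` for a minimal prime `P̂₁`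
    {K₁ : Type u} [Field K₁] [Algebra (AdicCompletion (maximalIdeal A) A) K₁] [Algebra A K₁]
    [IsScalarTower A (AdicCompletion (maximalIdeal A) A) K₁] [Algebra K K₁] [IsScalarTower A K K₁]
    (hP₁ : RingHom.ker (algebraMap (AdicCompletion (maximalIdeal A) A) K₁) ∈
      minimalPrimes (AdicCompletion (maximalIdeal A) A))
    (hK₁ : ∀ z : K₁, ∃ a b : AdicCompletion (maximalIdeal A) A,
      z = algebraMap _ K₁ a / algebraMap _ K₁ b)
    -- the regular local ring `S = 𝒪_{Ŷ,ŷ}` over `Â`, inside `K̂₁`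
    {S : Type u} [CommRing S] [IsRegularLocalRing S] [Algebra (AdicCompletion (maximalIdeal A) A) S]
    [IsLocalHom (algebraMap (AdicCompletion (maximalIdeal A) A) S)]
    [Algebra.EssFiniteType (AdicCompletion (maximalIdeal A) A) S] [Algebra A S]
    [IsScalarTower A (AdicCompletion (maximalIdeal A) A) S] [Algebra S K₁]
    [IsScalarTower (AdicCompletion (maximalIdeal A) A) S K₁]
    (hSK₁ : Function.Injective (algebraMap S K₁))
    -- the model `T ⊆ K`, integrally closed, mapping to `S`
    (T : Subalgebra A K) (hTfg : T.FG) (hTic : ∀ x : K, IsIntegral T x → x ∈ T)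
    [Algebra T S] [IsScalarTower A T S]
    -- `√(P S) = m_S` and algebraic residue field
    (hrad : ∀ Q : Ideal S, Q.IsPrime →
      ((maximalIdeal S).comap (algebraMap T S)).map (algebraMap T S) ≤ Q → Q = maximalIdeal S)
    (halg : ∀ x : S, ∃ p : A[X], (∃ i, p.coeff i ∉ maximalIdeal A) ∧
      p.eval₂ (algebraMap A S) x ∈ maximalIdeal S) :
    IsRegularLocalRing (Localization.AtPrime ((maximalIdeal S).comap (algebraMap T S))) := by
  classical
  haveI : IsNoetherianRing A := hA.1
  set Ah := AdicCompletion (maximalIdeal A) A with hAhdef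
  haveI : IsNoetherianRing Ah := isNoetherianRing_adicCompletion_maximalIdeal A
  haveI : Module.Flat A Ah := hA.isRegularHom_adicCompletion.1
  -- `T`: a Noetherian integrally closed domain with fraction field `K`, of finite type over `A`
  haveI : Algebra.FiniteType A T := (Subalgebra.fg_iff_finiteType _).mp hTfg
  haveI : Algebra.EssFiniteType A T := Algebra.EssFiniteType.of_finiteType A T
  haveI : IsNoetherianRing T := Algebra.FiniteType.isNoetherianRing A T
  haveI : IsFractionRing T K := inferInstance  -- `Localization.subalgebra.instIsFractionRing…`
  haveI : IsIntegrallyClosed T :=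
    (isIntegrallyClosed_iff K).mpr fun {x} hx => ⟨⟨x, hTic x hx⟩, rfl⟩
  set P : Ideal T := (maximalIdeal S).comap (algebraMap T S) with hPdef
  haveI : P.IsPrime := Ideal.IsPrime.comap _
  haveI : IsIntegrallyClosed (Localization.AtPrime P) :=
    isIntegrallyClosed_of_isLocalization (Localization.AtPrime P) P.primeCompl
      (le_nonZeroDivisors_of_noZeroDivisors fun h0 => h0 P.zero_mem)
  -- `T' = T ⊗_A Â` and `ψ : T' → S`
  set T' := (T : Type u) ⊗[A] Ah with hT'def
  let ψ : T' →ₐ[A] S := Algebra.TensorProduct.lift (IsScalarTower.toAlgHom A T S)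
    (IsScalarTower.toAlgHom A Ah S) (fun _ _ => Commute.all _ _)
  have hψ_left : ∀ x : T, ψ (algebraMap T T' x) = algebraMap T S x := fun x => by
    rw [Algebra.TensorProduct.algebraMap_apply, Algebra.TensorProduct.lift_tmul]
    simp
  have hψ_right : ∀ a : Ah, ψ ((1 : T) ⊗ₜ[A] a) = algebraMap Ah S a := fun a => by
    rw [Algebra.TensorProduct.lift_tmul]
    simp
  -- `P' := ψ⁻¹(m_S)`, a prime of `T'` over `P`; `N := T'_{P'}` is a normal domain (Stacks 0BFK)
  set P' : Ideal T' := (maximalIdeal S).comap ψ.toRingHom with hP'def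
  haveI : P'.IsPrime := Ideal.IsPrime.comap _
  haveI : P'.LiesOver P := ⟨Ideal.ext fun x => by
    change algebraMap T S x ∈ maximalIdeal S ↔ ψ (algebraMap T T' x) ∈ maximalIdeal S
    rw [hψ_left]⟩
  set N := Localization.AtPrime P' with hNdef
  obtain ⟨hNdom, hNic⟩ :=
    isDomain_and_isIntegrallyClosed_localization_tensor_adicCompletion hA P P'
  haveI := hNdom
  haveI := hNic
  -- the kernel of `T' → K̂₁` (= `ker ψ`) is a minimal prime of `T'`
  have hfrac : ∀ x : T, ∃ a t : A, t ≠ 0 ∧ t • x = algebraMap A T a := by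
    intro x
    obtain ⟨a, t, ht, hx⟩ := IsFractionRing.div_surjective (A := A) (x : K)
    refine ⟨a, t, nonZeroDivisors.ne_zero ht, Subtype.ext ?_⟩
    have htK : algebraMap A K t ≠ 0 := IsFractionRing.to_map_ne_zero_of_mem_nonZeroDivisors ht
    rw [Subalgebra.coe_smul, Subalgebra.coe_algebraMap, ← hx, Algebra.smul_def]
    field_simp
  let ψ₁ : T' →+* K₁ := (algebraMap S K₁).comp ψ.toRingHom
  have hker₁ : RingHom.ker (ψ₁.comp
      (Algebra.TensorProduct.includeRight (R := A) (A := (T : Type u))).toRingHom) =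
      RingHom.ker (algebraMap Ah K₁) := by
    ext a
    simp only [RingHom.mem_ker, RingHom.comp_apply, AlgHom.toRingHom_eq_coe, AlgHom.coe_toRingHom,
      Algebra.TensorProduct.includeRight_apply, ψ₁]
    rw [hψ_right, ← IsScalarTower.algebraMap_apply Ah S K₁]
  have hψA : ∀ t : A, t ≠ 0 → ψ₁ (algebraMap A T' t) ≠ 0 := by
    intro t ht h0
    apply ht
    have h1 : ψ₁ (algebraMap A T' t) = algebraMap A K₁ t := by
      simp only [ψ₁, RingHom.comp_apply, AlgHom.toRingHom_eq_coe, AlgHom.coe_toRingHom,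
        AlgHom.commutes]
      rw [IsScalarTower.algebraMap_apply A Ah S, ← IsScalarTower.algebraMap_apply Ah S K₁,
        ← IsScalarTower.algebraMap_apply A Ah K₁]
    rw [h1, IsScalarTower.algebraMap_apply A K K₁, map_eq_zero] at h0
    exact IsFractionRing.to_map_eq_zero_iff.mp h0
  have hkerψ : RingHom.ker ψ.toRingHom = RingHom.ker ψ₁ := by
    ext s
    simp only [RingHom.mem_ker, ψ₁, RingHom.comp_apply]
    constructor
    · intro h; rw [h, map_zero]
    · intro h; exact hSK₁ (by rw [map_zero]; exact h)
  have hPmin : RingHom.ker ψ.toRingHom ∈ minimalPrimes T' := by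
    rw [hkerψ]
    exact ker_mem_minimalPrimes_of_tensor hfrac ψ₁ hψA (by rw [hker₁]; exact hP₁)
  -- `ψN : N → S`, local and injective
  obtain ⟨ψN, hψN, hψNloc, hψNinj⟩ := exists_lift_localization_comap ψ.toRingHom N
  have hψN_inj : Function.Injective ψN := hψNinj inferInstance hPmin
  -- `√(𝔪_N S) = 𝔪_S`
  have hrad' : ∀ Q : Ideal S, Q.IsPrime → (maximalIdeal N).map ψN ≤ Q → Q = maximalIdeal S := by
    intro Q hQ hle
    refine hrad Q hQ (le_trans ?_ hle)
    rw [Ideal.map_le_iff_le_comap]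
    intro x hx
    rw [Ideal.mem_comap]
    have h1 : ψN (algebraMap T' N (algebraMap T T' x)) = algebraMap T S x :=
      (hψN _).trans (hψ_left x)
    rw [← h1]
    apply Ideal.mem_map_of_mem
    have h2 : algebraMap T T' x ∈ P' := by
      change ψ (algebraMap T T' x) ∈ maximalIdeal S
      rw [hψ_left]
      exact hx
    rw [← Localization.AtPrime.map_eq_maximalIdeal]
    exact Ideal.mem_map_of_mem _ h2
  -- residue field of `S` algebraic over `N`
  have hAN : ∀ a : A, ψN (algebraMap A N a) = algebraMap A S a := fun a => by
    rw [IsScalarTower.algebraMap_apply A T' N, hψN]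
    exact ψ.commutes a
  have halg' : ∀ x : S, ∃ p : N[X], (∃ i, p.coeff i ∉ maximalIdeal N) ∧
      p.eval₂ ψN x ∈ maximalIdeal S := by
    intro x
    obtain ⟨p, ⟨i, hi⟩, hp⟩ := halg x
    refine ⟨p.map (algebraMap A N), ⟨i, ?_⟩, ?_⟩
    · rw [coeff_map]
      have hu : IsUnit (p.coeff i) := IsLocalRing.notMem_maximalIdeal.mp hi
      exact IsLocalRing.notMem_maximalIdeal.mpr (hu.map _)
    · rw [eval₂_map]
      have : ψN.comp (algebraMap A N) = algebraMap A S := RingHom.ext hAN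
      rw [this]
      exact hp
  -- `Â → N` (through `T'`), compatible with `Â → S`
  letI : Algebra Ah N :=
    ((algebraMap T' N).comp (Algebra.TensorProduct.includeRight (R := A) (A := (T : Type u))
      (B := Ah)).toRingHom).toAlgebra
  have hcomm : ψN.comp (algebraMap Ah N) = algebraMap Ah S := RingHom.ext fun a => by
    change ψN (algebraMap T' N ((1 : T) ⊗ₜ[A] a)) = algebraMap Ah S a
    rw [hψN]
    exact hψ_right a
  -- Zariski's Main Theorem: `N = S`, so `N` is regular; then descend to `T_P`
  haveI : IsRegularLocalRing N :=
    (isRegularLocalRing_of_descent_core (R := Ah) ψN hψN_inj hψNloc hcomm hSK₁ hK₁ hrad' halg').2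
  exact isRegularLocalRing_localization_of_tensor (B := Ah) P P'

end Descent

end Literature.AlgebraicGeometry.Resolution
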